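import Literature.Computability.Complexity.SpaceQueryMachineRun
import Literature.Computability.Complexity.PolyExistsEnumeration
import HarnessLib

/-!
# Polynomial-space query loops: an `FP` round function consulting a `PSPACE` language in place

Capstone of the machine-level route `SpaceLoopBounded.lean` → `SpaceQueryMachine.lean` →
`SpaceQueryMachineRun.lean` (+ the orbit analysis of `PolyExistsEnumeration.lean`) to
Homer–Selman 2011, Thm. 5.10 / Cor. 5.7 and the proof of Prop. 7.5 ("`NP^PSPACE = PSPACE`, by
Corollary 5.7"): a polynomial-space algorithm may, in every round, ask ONE query `q` about a
language `A ∈ PSPACE` and receive the answer in place, because the space-bounded decider of `A`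
is re-run on `q` and its space reused (Arora–Barak 2009, §4.1; Hirahara–Lu–Ren 2023, Rem. 2,
`PSPACE^PSPACE = PSPACE`).

* `spaceRuns_comp_queryAux` — **one `FP` round followed by one `PSPACE` query runs in
  polynomial total stack length**: the sequential composite (`Turing.TM2ComputableAux.comp`) of
  the polynomial-time machine of `F` with the query transducer `SpaceQuery.queryAux N` of a space
  machine `N` deciding `A` computes `SpaceQuery.answerFn A ∘ F` (`0 q ↦ 0 [q ∈ A] q` on the
  round's output) with `SpaceLoop.SpaceRuns` bound `W + 2 + S W`, `W = n + #stacks · D · T n`;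
* `mem_PSPACE_of_queryLoop` — **the query-loop principle**: if `F ∈ FP`, `A ∈ PSPACE`, the
  `SpaceLoop.orbit` of `answerFn A ∘ F` on every input `x` stays of polynomial length up to its
  first flagged word, and that word is `1 [x ∈ L] …`, then `L ∈ PSPACE`
  (`SpaceLoop.mem_PSPACE_of_space` applied to the composite);
* `mem_PSPACE_of_polyExists_witness`, `polyExists_PSPACE_subset_PSPACE_of_queryLoop` — the
  instance `∃ᵖ·PSPACE ⊆ PSPACE` with the round function `PolyExistsEnum.enumFn p` (certificates
  enumerated by (length, value), one query `⟨x, y⟩` per round). This is a second, direct proof of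
  the named fact `polyExists_PSPACE_subset_PSPACE` of `SpaceOracles.lean`, whose discharge of
  record is `polyExists_PSPACE_subset_PSPACE_holds` (`SpaceOraclesProofs.lean`, through the orbit
  deciders of `OrbitDeciders*.lean` and the `PSPACE`-completeness of `SPACETMSAT`); the present
  route needs no complete problem and keeps the decider of the `PSPACE` predicate as a black-box
  space machine.

## References

* S. Homer, A. L. Selman, *Computability and Complexity Theory*, 2nd ed., Springer 2011,
  Thm. 5.10 and Cor. 5.7 (pp. 92–93 of the held copy: enumeration of the choice strings, the
  machine re-run in the space of one computation), proof of Prop. 7.5 (p. 150), Thm. 7.18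
  (p. 161). [HomerSelman2011]
* S. Arora, B. Barak, *Computational Complexity: A Modern Approach*, CUP 2009, §4.1 (`NP ⊆
  PSPACE`: space is reused), Thm. 4.2. [AroraBarak2009]
* S. Hirahara, Z. Lu, H. Ren, *Bounded relativization*, CCC 2023, Rem. 2. [HiraharaLuRen2023]
-/

noncomputable section

namespace Literature.Computability.Complexity

open _root_.Computability Turing Polynomial SpaceLoop SpaceQuery PolyExistsEnum TM2Comp

/-! ### One `FP` round followed by one `PSPACE` query -/

/-- **An `FP` round followed by a `PSPACE` query runs in polynomial total stack length.** If `Mx`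
computes `F` within the polynomial time bound `T` and the input-preserving space machine `N`
decides `A` in work space `Sf ≤ S ∘ length` (`S` monotone), then the composite of `Mx` with the
query transducer of `N` computes `answerFn A ∘ F` (the query `0 q` produced by the round is
answered in place: `0 [q ∈ A] q`) from `initList` to `haltList` through configurations of total
stack length `≤ W + 2 + S W`, `W = n + #stacks · D · T n` — the first phase by the time bound
(`SpaceLoop.spaceRuns_of_outputsWithin`), the second by `SpaceQuery.spaceRuns_answerFn`, glued
by `TM2Comp.runsVia_stkLen_compTM`. [cite: HomerSelman2011, Thm. 5.10 and proof of Prop. 7.5 (NP^PSPACE = PSPACE: the oracle queries are answered by a PSPACE computation in place)] -/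
theorem spaceRuns_comp_queryAux (Mx : TM2ComputableAux Bool Bool) {F : List Bool → List Bool}
    (T : Polynomial ℕ) (hMx : ∀ u, Mx.OutputsWithin u (F u) (T.eval u.length))
    (N : SpaceMachine Bool Bool) {A : Language Bool} {Sf : List Bool → ℕ} (hN : DecidesInSpace N A Sf)
    (S : ℕ → ℕ) (hS : Monotone S) (hSf : ∀ q, Sf q ≤ S q.length) :
    SpaceRuns (Mx.comp (queryAux N)).tm (Mx.comp (queryAux N)).inputAlphabet
      (Mx.comp (queryAux N)).outputAlphabet (answerFn A ∘ F)
      (fun n => (n + nStk Mx.tm * machinePushBound Mx.tm * T.eval n) + 2 +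
        S (n + nStk Mx.tm * machinePushBound Mx.tm * T.eval n)) := by
  intro u
  set W : ℕ := u.length + nStk Mx.tm * machinePushBound Mx.tm * T.eval u.length with hW
  set e := Mx.outputAlphabet.trans (queryAux N).inputAlphabet.symm with he
  -- the output of the round is no longer than the space of its computation
  have hlen : (F u).length ≤ W := by
    have h := (hMx u).length_le
    have hpos : 0 < nStk Mx.tm := by
      letI := Mx.tm.kFin
      exact Fintype.card_pos_iff.2 ⟨Mx.tm.k₀⟩
    have : machinePushBound Mx.tm * T.eval u.length ≤
        nStk Mx.tm * machinePushBound Mx.tm * T.eval u.length := by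
      rw [Nat.mul_assoc]; exact Nat.le_mul_of_pos_left _ hpos
    omega
  have hB₂ : (F u).length + 2 + S (F u).length ≤ W + 2 + S W := by
    have := hS hlen; omega
  -- phase 1: the polynomial-time machine
  have h₁ := (spaceRuns_of_outputsWithin (T := fun n => T.eval n) hMx u).mono
    (Q := fun c => stkLen Mx.tm c.stk ≤ W + 2 + S W) (fun c hc => by dsimp only at hc; omega)
  -- phase 2: the query transducer
  have h₂ : RunsVia (queryAux N).tm.step (fun c => stkLen (queryAux N).tm c.stk ≤ W + 2 + S W)
      (initList (queryAux N).tm (((F u).map Mx.outputAlphabet.symm).map e))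
      (haltList (queryAux N).tm ((answerFn A (F u)).map (queryAux N).outputAlphabet.symm)) := by
    have hl' : ((F u).map Mx.outputAlphabet.symm).map e = (F u).map (queryAux N).inputAlphabet.symm := by
      simp [he, List.map_map]
    rw [hl']
    exact (spaceRuns_answerFn N hN S hS hSf (F u)).mono fun c hc => hc.trans hB₂
  have H := runsVia_stkLen_compTM Mx.tm (queryAux N).tm e h₁ h₂
  rw [List.map_map] at H
  exact H

/-! ### The query-loop principle -/

/-- **The query-loop principle.** Let `F ∈ FP` be a round function and `A ∈ PSPACE`; the loop
machine feeds `0 x`, then `1 w` for the previous ANSWERED output `w = answerFn A (F …)` (a query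
`0 q` of the round comes back as `0 [q ∈ A] q`). If on every input `x` the orbit words up to the
first flagged one have length `≤ s(|x|)` and the first flagged word is `1 [x ∈ L] …`, then
`L ∈ PSPACE`: the iterated machine is the composite of the machine of `F` with the query
transducer of a space machine for `A` (`spaceRuns_comp_queryAux`), iterated in place by the loop
machine (`SpaceLoop.mem_PSPACE_of_space`). [cite: HomerSelman2011, proof of Prop. 7.5 (NP^PSPACE = PSPACE, by Cor. 5.7) and Thm. 5.10] [cite: HiraharaLuRen2023, Rem. 2 (PSPACE^PSPACE = PSPACE)] -/
theorem mem_PSPACE_of_queryLoop {F : List Bool → List Bool} (hF : F ∈ FP) {A L : Language Bool}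
    (hA : A ∈ PSPACE) (s : Polynomial ℕ)
    (hs : ∀ x k, (∀ j < k, ∃ w', orbit (answerFn A ∘ F) x j = false :: w') →
      (orbit (answerFn A ∘ F) x k).length ≤ s.eval x.length)
    (hhalt : ∀ x, ∃ n w, orbit (answerFn A ∘ F) x n = true :: L.boolIndicator x :: w ∧
      ∀ k < n, ∃ w', orbit (answerFn A ∘ F) x k = false :: w') :
    L ∈ PSPACE := by
  -- a space machine for `A`
  obtain ⟨k, hk⟩ := Set.mem_iUnion.1 hA
  obtain ⟨c, N, hN⟩ := hk
  change DecidesInSpace N A (fun x => c * x.length ^ k + c) at hN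
  -- the polynomial-time machine of the round function
  obtain ⟨T, Mx, hMx⟩ := hF
  -- the space bound of the decider, as a monotone function of the length
  set S : ℕ → ℕ := fun n => c * n ^ k + c with hS
  have hSm : Monotone S := fun a b h => by
    have := Nat.pow_le_pow_left h k
    simp only [hS]
    nlinarith [Nat.mul_le_mul_left c this]
  have hSR := spaceRuns_comp_queryAux Mx T hMx N hN S hSm (fun q => le_rfl)
  -- the total space bound `R` and a polynomial dominating it
  set K : ℕ := nStk Mx.tm * machinePushBound Mx.tm with hK
  have hTm : Monotone fun n => T.eval n := fun a b h => TM2Iter.eval_mono T h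
  have hRm : Monotone fun n => (n + K * T.eval n) + 2 + S (n + K * T.eval n) := by
    intro a b h
    have h1 : a + K * T.eval a ≤ b + K * T.eval b := Nat.add_le_add h (Nat.mul_le_mul_left _ (hTm h))
    have h2 := hSm h1
    dsimp only
    omega
  set r : Polynomial ℕ := (X + C K * T + 2) + (C c * (X + C K * T) ^ k + C c) with hr
  have hRr : ∀ n, (n + K * T.eval n) + 2 + S (n + K * T.eval n) ≤ r.eval n := fun n =>
    le_of_eq (by simp [hr, hS])
  exact mem_PSPACE_of_space (Mx.comp (queryAux N)).tm (Mx.comp (queryAux N)).inputAlphabet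
    (Mx.comp (queryAux N)).outputAlphabet hRm r hRr hSR s hs hhalt

/-! ### `∃ᵖ·PSPACE ⊆ PSPACE` by the query loop -/

/-- **A `polyExists` witness over a `PSPACE` predicate puts the language in `PSPACE`**: if
`L' ∈ PSPACE` and `x ∈ L ↔ ∃ y, |y| ≤ p(|x|) ∧ ⟨x, y⟩ ∈ L'`, then `L ∈ PSPACE` — the query loop of
the round function `PolyExistsEnum.enumFn p` (the candidates `y` in (length, value) order, one
query `⟨x, y⟩` per round, accept at the first `1`, reject when the strings of length `≤ p(|x|)` are
exhausted; orbit analysis `PolyExistsEnum.orbit_length_le` / `orbit_halts`).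
[cite: HomerSelman2011, Thm. 5.10 and Cor. 5.7 (enumeration of the choice strings in the space of one computation); proof of Prop. 7.5] -/
theorem mem_PSPACE_of_polyExists_witness {L L' : Language Bool} (hL' : L' ∈ PSPACE)
    (p : Polynomial ℕ)
    (hL : ∀ x, x ∈ L ↔ ∃ y : List Bool, y.length ≤ p.eval x.length ∧ boolPair x y ∈ L') :
    L ∈ PSPACE :=
  mem_PSPACE_of_queryLoop (enumFn_mem_FP p) hL' (2 * X + p + 4)
    (fun x n hn => orbit_length_le p L' (G := answerFn L') (answerFn_false L') (answerFn_true L') hL x n hn)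
    (fun x => orbit_halts p L' (G := answerFn L') (answerFn_false L') (answerFn_true L') hL x)

/-- **`∃ᵖ·PSPACE ⊆ PSPACE` by the query loop** — a second, direct proof of the named fact
`polyExists_PSPACE_subset_PSPACE` of `SpaceOracles.lean` (its discharge of record,
`polyExists_PSPACE_subset_PSPACE_holds` of `SpaceOraclesProofs.lean`, goes through orbit deciders
and the `PSPACE`-complete `SPACETMSAT`; this one keeps the decider of the predicate as a
black-box space machine). [cite: HomerSelman2011, Thm. 5.10 and Cor. 5.7; proof of Prop. 7.5 ("NP^PSPACE = PSPACE, by Corollary 5.7")] -/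
theorem polyExists_PSPACE_subset_PSPACE_of_queryLoop : polyExists PSPACE ⊆ PSPACE := by
  rintro L ⟨L', hL', p, hL⟩
  exact mem_PSPACE_of_polyExists_witness hL' p hL

end Literature.Computability.Complexity

end
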